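import Mathlib
import Literature.Probability.LatticeModels.IsoradialPercolation
import Literature.Probability.Percolation.PercolationProofs
import HarnessLib

/-!
# `NoHeavyLowerTail` (stmt-CriticalPhenomena-4575), line `one-cut-entropy-shearer` — the pair-projection (dense-regime) bound

Hypothesis-free part of the entropy/Shearer line (route-task nh7-entropy, 2026-08-18).  For `μ = prodBernoulli w` on `Fin n`, relays `A`
(`k = |A|`), observer `o`, `N(ω) = #{a ∈ A : o ↔ a}` and `t ≥` every pairwise disconnection probability among distinct relays:

* `nhlt_pairProjection_sum` — `Σ_{a ≠ a' ∈ A} μ(o ↔ a, o ↮ a') ≤ t · k(k−1)/2`: the ordered pairs `(a, a')` with `o ↔ a`, `o ↮ a'` number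
  `N(k − N)`, and for each unordered pair the two events `{o↔a, o↮a'}`, `{o↔a', o↮a}` are disjoint sub-events of `{a ↮ a'}` (no correlation
  inequality is used);
* `nhlt_pairProjection` — for `1 ≤ s` and `2s ≤ k`: `μ(s ≤ N ≤ k − s) ≤ t · k(k−1) / (2 s (k−s))` (Markov for `N(k−N) ≥ s(k−s)` on the event).

So the DENSE part `{ck ≤ N < E N/2}` of the one-cut event costs `O(t)` uniformly in `|A|` with no hub and no positive association; the
content of the engine `stub_oneCut` is the sparse regime `1 ≤ N ≤ ck` (cf. `nhlt_hubBlockMarkov`, which needs `o ↔ a₀`).  Bookkeeping.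
-/

noncomputable section

namespace Summit.CriticalPhenomena.PercolationContinuityZ3.Theorems

open MeasureTheory Set
open Literature.Probability.LatticeModels (prodBernoulli)
open Literature.Probability.Percolation (openConn openGraph measurableSet_openConn_holds)
open scoped Classical BigOperators

variable {n : ℕ}

/-- For an unordered pair of relays, the two discordance events `{o ↔ a, o ↮ a'}` and `{o ↔ a', o ↮ a}` are disjoint
sub-events of `{a ↮ a'}`: `μ(o↔a, o↮a') + μ(o↔a', o↮a) ≤ μ(a ↮ a')`. [this file] -/
theorem nhlt_discordance_pair_le (w : Sym2 (Fin n) → unitInterval) (o a a' : Fin n) :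
    (prodBernoulli w).real (openConn o a ∩ (openConn o a')ᶜ) +
        (prodBernoulli w).real (openConn o a' ∩ (openConn o a)ᶜ) ≤
      (prodBernoulli w).real (openConn a a')ᶜ := by
  set μ := prodBernoulli w with hμ
  have hdisj : Disjoint (openConn o a ∩ (openConn o a')ᶜ : Set (Set (Sym2 (Fin n))))
      (openConn o a' ∩ (openConn o a)ᶜ) :=
    Set.disjoint_left.2 fun ω h1 h2 => h2.2 h1.1
  rw [← measureReal_union hdisj MeasurableSet.of_discrete]
  refine measureReal_mono ?_
  rintro ω (⟨h1, h2⟩ | ⟨h1, h2⟩) h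
  · have h' : (openGraph ω).Reachable a a' := h
    exact h2 ((show (openGraph ω).Reachable o a from h1).trans h')
  · have h' : (openGraph ω).Reachable a a' := h
    exact h2 ((show (openGraph ω).Reachable o a' from h1).trans h'.symm)

/-- **Pair projection, summed.**  `Σ_{a ∈ A} Σ_{a' ∈ A ∖ a} μ(o ↔ a, o ↮ a') ≤ t · (k(k−1)/2)` whenever all pairwise disconnection
probabilities among distinct relays are `≤ t` (symmetrise the double sum and use `nhlt_discordance_pair_le`). [this file] -/
theorem nhlt_pairProjection_sum (w : Sym2 (Fin n) → unitInterval) (A : Finset (Fin n)) (o : Fin n) (t : ℝ)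
    (hpair : ∀ a ∈ A, ∀ a' ∈ A, a ≠ a' → (prodBernoulli w).real (openConn a a')ᶜ ≤ t) :
    ∑ a ∈ A, ∑ a' ∈ A.erase a, (prodBernoulli w).real (openConn o a ∩ (openConn o a')ᶜ) ≤
      t * ((A.card : ℝ) * (A.card - 1) / 2) := by
  set μ := prodBernoulli w with hμ
  set f : Fin n → Fin n → ℝ := fun a a' => μ.real (openConn o a ∩ (openConn o a')ᶜ) with hf
  -- symmetrisation: 2 Σ f = Σ (f + fᵀ) ≤ k(k-1) t
  have hsymm : ∑ a ∈ A, ∑ a' ∈ A.erase a, f a a' = ∑ a ∈ A, ∑ a' ∈ A.erase a, f a' a := by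
    rw [Finset.sum_comm' (t' := A) (s' := fun a' => A.erase a')]
    intro a a'
    constructor
    · rintro ⟨ha, ha'⟩
      exact ⟨Finset.mem_erase.2 ⟨(Finset.ne_of_mem_erase ha').symm, ha⟩, Finset.mem_of_mem_erase ha'⟩
    · rintro ⟨ha, ha'⟩
      exact ⟨Finset.mem_of_mem_erase ha, Finset.mem_erase.2 ⟨(Finset.ne_of_mem_erase ha).symm, ha'⟩⟩
  have hbound : ∑ a ∈ A, ∑ a' ∈ A.erase a, (f a a' + f a' a) ≤ ∑ a ∈ A, ∑ _a' ∈ A.erase a, t := by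
    refine Finset.sum_le_sum fun a ha => Finset.sum_le_sum fun a' ha' => ?_
    exact (nhlt_discordance_pair_le w o a a').trans
      (hpair a ha a' (Finset.mem_of_mem_erase ha') (Finset.ne_of_mem_erase ha').symm)
  have hconst : ∑ a ∈ A, ∑ _a' ∈ A.erase a, t = (A.card : ℝ) * (A.card - 1) * t := by
    rw [Finset.sum_congr rfl fun a ha => by rw [Finset.sum_const, Finset.card_erase_of_mem ha, nsmul_eq_mul]]
    rw [Finset.sum_const, nsmul_eq_mul]
    have hk : 1 ≤ A.card ∨ A.card = 0 := by omega
    rcases hk with hk | hk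
    · rw [Nat.cast_sub hk]; push_cast; ring
    · rw [hk]; simp
  have h2 : 2 * ∑ a ∈ A, ∑ a' ∈ A.erase a, f a a' ≤ (A.card : ℝ) * (A.card - 1) * t := by
    rw [two_mul]
    nth_rewrite 2 [hsymm]
    rw [← Finset.sum_add_distrib]
    simp_rw [← Finset.sum_add_distrib]
    exact hbound.trans hconst.le
  show ∑ a ∈ A, ∑ a' ∈ A.erase a, f a a' ≤ t * ((A.card : ℝ) * (A.card - 1) / 2)
  linarith

/-- **Pair projection (dense-regime bound).**  For `1 ≤ s`, `2 s ≤ |A|` and `t` bounding all pairwise disconnection probabilities among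
distinct relays: `μ(s ≤ N ≤ |A| − s) ≤ t · |A|(|A|−1) / (2 s (|A| − s))`, `N = #{a ∈ A : o ↔ a}`.  On the event the number `N(|A| − N)` of
ordered discordant pairs is `≥ s(|A| − s)`; Markov and `nhlt_pairProjection_sum`.  No hub, no correlation inequality. [this file] -/
theorem nhlt_pairProjection (w : Sym2 (Fin n) → unitInterval) (A : Finset (Fin n)) (o : Fin n) (t : ℝ) (s : ℕ)
    (hs : 1 ≤ s) (h2s : 2 * s ≤ A.card)
    (hpair : ∀ a ∈ A, ∀ a' ∈ A, a ≠ a' → (prodBernoulli w).real (openConn a a')ᶜ ≤ t) :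
    (prodBernoulli w).real {ω : Set (Sym2 (Fin n)) | s ≤ (A.filter fun a => ω ∈ openConn o a).card ∧
        (A.filter fun a => ω ∈ openConn o a).card ≤ A.card - s} ≤
      t * ((A.card : ℝ) * (A.card - 1) / 2) / ((s : ℝ) * (A.card - s)) := by
  set μ := prodBernoulli w with hμ
  set k := A.card with hk
  -- the number of ordered discordant pairs, as a sum of indicators
  set Y : Set (Sym2 (Fin n)) → ℝ := fun ω =>
    ∑ a ∈ A, ∑ a' ∈ A.erase a, (openConn o a ∩ (openConn o a')ᶜ : Set (Set (Sym2 (Fin n)))).indicator (fun _ => (1 : ℝ)) ω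
    with hY
  have hint : ∀ a a' : Fin n, Integrable
      ((openConn o a ∩ (openConn o a')ᶜ : Set (Set (Sym2 (Fin n)))).indicator (fun _ => (1 : ℝ))) μ :=
    fun a a' => (integrable_const (1 : ℝ)).indicator MeasurableSet.of_discrete
  have hY_int : Integrable Y μ :=
    integrable_finsetSum A fun a _ => integrable_finsetSum (A.erase a) fun a' _ => hint a a'
  have hY_nonneg : 0 ≤ᵐ[μ] Y := Filter.Eventually.of_forall fun ω =>
    Finset.sum_nonneg fun a _ => Finset.sum_nonneg fun a' _ => Set.indicator_nonneg (fun _ _ => zero_le_one) _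
  have hY_integral : ∫ ω, Y ω ∂μ = ∑ a ∈ A, ∑ a' ∈ A.erase a, μ.real (openConn o a ∩ (openConn o a')ᶜ) := by
    rw [integral_finsetSum A fun a _ => integrable_finsetSum (A.erase a) fun a' _ => hint a a']
    refine Finset.sum_congr rfl fun a _ => ?_
    rw [integral_finsetSum (A.erase a) fun a' _ => hint a a']
    refine Finset.sum_congr rfl fun a' _ => ?_
    rw [integral_indicator_const (1 : ℝ) MeasurableSet.of_discrete, smul_eq_mul, mul_one]
  -- on the event, `Y = N (k - N) ≥ s (k - s)`
  have hYval : ∀ ω : Set (Sym2 (Fin n)),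
      Y ω = ((A.filter fun a => ω ∈ openConn o a).card : ℝ) * (k - (A.filter fun a => ω ∈ openConn o a).card : ℕ) := by
    intro ω
    set S := A.filter fun a => ω ∈ openConn o a with hS
    have hterm : ∀ a ∈ A, ∑ a' ∈ A.erase a,
        (openConn o a ∩ (openConn o a')ᶜ : Set (Set (Sym2 (Fin n)))).indicator (fun _ => (1 : ℝ)) ω =
          if ω ∈ openConn o a then ((A.filter fun a' => ω ∉ openConn o a').card : ℝ) else 0 := by
      intro a ha
      by_cases hoa : ω ∈ openConn o a
      · rw [if_pos hoa]
        have : ∀ a' ∈ A.erase a, (openConn o a ∩ (openConn o a')ᶜ : Set (Set (Sym2 (Fin n)))).indicator (fun _ => (1 : ℝ)) ω =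
            if ω ∉ openConn o a' then (1 : ℝ) else 0 := by
          intro a' _
          by_cases h' : ω ∈ openConn o a' <;> simp [Set.indicator, hoa, h']
        rw [Finset.sum_congr rfl this, Finset.sum_boole]
        congr 2
        ext a'
        simp only [Finset.mem_filter, Finset.mem_erase]
        constructor
        · rintro ⟨⟨-, ha'A⟩, h'⟩; exact ⟨ha'A, h'⟩
        · rintro ⟨ha'A, h'⟩
          refine ⟨⟨?_, ha'A⟩, h'⟩
          rintro rfl; exact h' hoa
      · rw [if_neg hoa]
        refine Finset.sum_eq_zero fun a' _ => ?_
        simp [Set.indicator, hoa]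
    have hcompl : ((A.filter fun a' => ω ∉ openConn o a').card : ℝ) = (k - S.card : ℕ) := by
      have := Finset.card_filter_add_card_filter_not (s := A) (fun a' => ω ∈ openConn o a')
      rw [← hS] at this
      have hle : S.card ≤ k := by rw [hS]; exact Finset.card_filter_le _ _
      congr 1
      omega
    simp only [hY]
    rw [Finset.sum_congr rfl hterm, ← Finset.sum_filter, Finset.sum_const, nsmul_eq_mul, hcompl]
  have hsub : {ω : Set (Sym2 (Fin n)) | s ≤ (A.filter fun a => ω ∈ openConn o a).card ∧
        (A.filter fun a => ω ∈ openConn o a).card ≤ k - s} ⊆ {ω | ((s : ℝ) * (k - s : ℕ)) ≤ Y ω} := by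
    rintro ω ⟨h1, h2⟩
    show ((s : ℝ) * (k - s : ℕ)) ≤ Y ω
    rw [hYval ω]
    set N := (A.filter fun a => ω ∈ openConn o a).card
    have hNk : N ≤ k := Finset.card_filter_le _ _
    have e1 : ((k - s : ℕ) : ℝ) = (k : ℝ) - s := by rw [Nat.cast_sub (by omega)]
    have e2 : ((k - N : ℕ) : ℝ) = (k : ℝ) - N := by rw [Nat.cast_sub hNk]
    rw [e1, e2]
    have h1' : (s : ℝ) ≤ N := by exact_mod_cast h1
    have h2' : (N : ℝ) ≤ (k : ℝ) - s := by
      have : ((N : ℕ) : ℝ) ≤ ((k - s : ℕ) : ℝ) := by exact_mod_cast h2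
      rwa [e1] at this
    nlinarith
  have hpos : (0 : ℝ) < (s : ℝ) * (k - s : ℕ) := by
    have : 0 < k - s := by omega
    positivity
  have hmarkov := mul_meas_ge_le_integral_of_nonneg hY_nonneg hY_int ((s : ℝ) * (k - s : ℕ))
  rw [hY_integral] at hmarkov
  have hsum := nhlt_pairProjection_sum w A o t hpair
  have e1 : ((k - s : ℕ) : ℝ) = (k : ℝ) - s := by rw [Nat.cast_sub (by omega)]
  calc μ.real {ω : Set (Sym2 (Fin n)) | s ≤ (A.filter fun a => ω ∈ openConn o a).card ∧
          (A.filter fun a => ω ∈ openConn o a).card ≤ k - s}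
      ≤ μ.real {ω | ((s : ℝ) * (k - s : ℕ)) ≤ Y ω} := measureReal_mono hsub
    _ ≤ (t * ((k : ℝ) * (k - 1) / 2)) / ((s : ℝ) * (k - s : ℕ)) := by
        rw [le_div_iff₀ hpos]
        calc μ.real {ω | ((s : ℝ) * (k - s : ℕ)) ≤ Y ω} * ((s : ℝ) * (k - s : ℕ))
            = ((s : ℝ) * (k - s : ℕ)) * μ.real {ω | ((s : ℝ) * (k - s : ℕ)) ≤ Y ω} := mul_comm _ _
          _ ≤ ∑ a ∈ A, ∑ a' ∈ A.erase a, μ.real (openConn o a ∩ (openConn o a')ᶜ) := hmarkov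
          _ ≤ t * ((k : ℝ) * (k - 1) / 2) := hsum
    _ = t * ((k : ℝ) * (k - 1) / 2) / ((s : ℝ) * (k - s)) := by rw [e1]

end Summit.CriticalPhenomena.PercolationContinuityZ3.Theorems
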